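import Summits.Ventures.CertifiedManyBodySolver.Rows.TorusCeilingCRT
import HarnessLib

/-!
# Torus ceiling — Part V-c: integer-matrix lattice maps `ℤ^d →+ (ℤ/N)^{d'}` and the second tilted
# 16-site torus `Λ₁₆″ = ⟨(4,0),(2,4)⟩` in its four-copy presentation inside `(ℤ/8)²`

HONEST FRAMING: first certified bounds; not a superconductivity verdict; every number certified or
labelled float.

Part V (`TorusCeilingCRT`) presents tori with CYCLIC quotient as circulant rings
(`ringHom N p : ℤ^d →+ ℤ/N`, `d' = 1`); Part V-b (`TorusCeilingTilt16`) used it for the tilted torus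
`Λ₁₆′ = ⟨(4,0),(1,4)⟩` (`ℤ²/Λ₁₆′ = ℤ/16`). The other tilted 16-site period lattice of the `(4,4)` window
class, `Λ₁₆″ = ⟨(4,0),(2,4)⟩`, has quotient `ℤ/2 × ℤ/8`, which is not of the form `(ℤ/N)^{d'}`, so no
SURJECTIVE lattice map onto a `TorusSite d' N` has kernel `Λ₁₆″`. Part IV
(`homTorus_minEnergyOn_div_ge_of_window_certificate`), however, has NO surjectivity hypothesis: it
needs only non-degenerate hops and window injectivity. This file therefore (i) introduces the general
integer-matrix lattice map `latHom N P : ℤ^d →+ (ℤ/N)^{d'}`, `x ↦ (Σᵢ xᵢ P_{ji} mod N)ⱼ`, with its hop,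
non-degeneracy and spread-injectivity lemmas (the `d' = 1` case is `ringHom`), and (ii) instantiates
Part IV at `tiltHom16b = latHom 8 [[4,0],[2,1]]`, i.e. `(x, y) ↦ (4x, 2x + y) ∈ (ℤ/8)²`, whose kernel is
exactly `Λ₁₆″` (it kills `(4,0)` and `(2,4)`, and its image `{(0,k), (4,2+k)}` has order `16`). The model
`homHubbard tiltHom16b t U` lives on the `64` sites of `(ℤ/8)²` and is the DISJOINT UNION of four copies
of the nearest-neighbour Hubbard model of the torus `ℤ²/Λ₁₆″` (one per coset of the image); the theorem
`tilt16b_minEnergyOn_div_ge_of_window_certificate` says that every square-lattice window certificate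
of coordinate spreads `≤ 3, ≤ 3` bounds ITS `S^z = 0` ground-energy density from below.

What this file does NOT contain (paper step, recorded so that no label overstates it): to compare the
bound with a certified upper bound computed on ONE 16-site copy (e.g. its `(7,7)` sector) one still
needs `minEnergyOn_{64} (szSector 56 0) ≤ 4 · minEnergyOn_{16} (7,7)` — the fermionic product state over
the four Jordan–Wigner-consecutive copies (`Literature/…/QuantumLattice/TwoClusterFock.lean` has the
two-cluster version: product states of even eigenvectors are eigenvectors with the sum of the
energies). Until that reduction is filed, `Λ₁₆″` rows are KERNEL-capped only in the 64-site form and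
PAPER-admissible as 16-site cap rows.

References: Han 2020 §3; Kull–Schuch–Dive–Navascués 2024 §5.3. [cite: Han2020Bootstrap, §3]
[cite: KullEtAl2024, §5.3]
-/

noncomputable section

open Matrix Finset
open Literature.MathematicalPhysics.QuantumLattice
open Literature.MathematicalPhysics.QuantumFieldTheory hiding Site
open Literature.MathematicalPhysics.QuantumManyBody.StateRelaxation
open Literature.Probability.LatticeModels
open HubbardWave0
open scoped ComplexOrder ComplexConjugate

namespace Summit.Ventures.CertifiedManyBodySolver.Rows

section LatHom

variable {d d' : ℕ}

/-- The additive map `ℤ^d →+ (ℤ/N)^{d'}`, `x ↦ (Σᵢ xᵢ·P j i mod N)ⱼ`, of an integer `d' × d` matrix `P`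
(column `i` = the image of the hop `eᵢ`); `d' = 1` is `ringHom`. Not required to be surjective.
[folklore] -/
def latHom (N : ℕ) (P : Fin d' → Fin d → ℤ) : Site d →+ TorusSite d' N where
  toFun x := fun j => ((∑ i, x i * P j i : ℤ) : ZMod N)
  map_zero' := by funext; simp
  map_add' x y := by
    funext j
    simp only [Pi.add_apply, add_mul, Finset.sum_add_distrib, Int.cast_add]

/-- `latHom N P x j = (Σᵢ xᵢ P j i) mod N`. [folklore] -/
theorem latHom_apply (N : ℕ) (P : Fin d' → Fin d → ℤ) (x : Site d) (j : Fin d') :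
    latHom N P x j = ((∑ i, x i * P j i : ℤ) : ZMod N) := rfl

/-- The hops of `latHom N P`: `eᵢ ↦ (P j i mod N)ⱼ` (column `i`). [folklore] -/
theorem latHom_unitVec (N : ℕ) (P : Fin d' → Fin d → ℤ) (i : Fin d) :
    latHom N P (unitVec i) = fun j => ((P j i : ℤ) : ZMod N) := by
  funext j
  rw [latHom_apply, Finset.sum_eq_single i
    (fun k _ hk => by rw [show unitVec i k = 0 from Pi.single_eq_of_ne hk _, zero_mul])
    (fun h => absurd (Finset.mem_univ i) h), show unitVec i i = 1 from Pi.single_eq_same _ _, one_mul]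

/-- The signed hops of `latHom N P` are the columns `±P·i mod N`. [folklore] -/
theorem signedHop_latHom (N : ℕ) (P : Fin d' → Fin d → ℤ) (q : Fin d × Bool) :
    signedHop (latHom N P) q =
      fun j => bif q.2 then ((P j q.1 : ℤ) : ZMod N) else -((P j q.1 : ℤ) : ZMod N) := by
  unfold signedHop
  rw [latHom_unitVec]
  cases q.2 <;> rfl

/-- Non-degeneracy of the hops of `latHom N P` is the finite check "the `2d` signed columns
`±P·i mod N` are pairwise distinct in `(ℤ/N)^{d'}`". [folklore] -/
theorem injective_signedHop_latHom (N : ℕ) (P : Fin d' → Fin d → ℤ)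
    (h : Function.Injective fun q : Fin d × Bool =>
      fun j : Fin d' => bif q.2 then ((P j q.1 : ℤ) : ZMod N) else -((P j q.1 : ℤ) : ZMod N)) :
    Function.Injective (signedHop (latHom N P)) := by
  intro q q' hqq'
  rw [signedHop_latHom, signedHop_latHom] at hqq'
  exact h hqq'

/-- **Injectivity of `latHom N P` on a window from coordinate spreads** (`d = d' = 2`): if the only
solution of `N ∣ a P₀₀ + b P₀₁`, `N ∣ a P₁₀ + b P₁₁` with `|a| ≤ M₀`, `|b| ≤ M₁` is `a = b = 0`, then
`latHom N P` is injective on every `S ⊆ ℤ²` of coordinate spreads `≤ M₀`, `≤ M₁`. [folklore] -/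
theorem injOn_latHom_two_two_of_spread (N : ℕ) (P : Fin 2 → Fin 2 → ℤ) {M₀ M₁ : ℕ}
    (hN : ∀ a b : ℤ, -(M₀ : ℤ) ≤ a → a ≤ M₀ → -(M₁ : ℤ) ≤ b → b ≤ M₁ →
      (N : ℤ) ∣ a * P 0 0 + b * P 0 1 → (N : ℤ) ∣ a * P 1 0 + b * P 1 1 → a = 0 ∧ b = 0)
    {S : Finset (Site 2)} (hspread : ∀ x ∈ S, ∀ y ∈ S, |x 0 - y 0| ≤ (M₀ : ℤ) ∧ |x 1 - y 1| ≤ (M₁ : ℤ)) :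
    Set.InjOn (latHom N P) ↑S := by
  intro x hx y hy hxy
  have h := congrFun hxy 0
  have h' := congrFun hxy 1
  rw [latHom_apply, latHom_apply, ZMod.intCast_eq_intCast_iff_dvd_sub, Fin.sum_univ_two,
    Fin.sum_univ_two] at h h'
  obtain ⟨h₀, h₁⟩ := hspread x hx y hy
  rw [abs_le] at h₀ h₁
  have key := hN (y 0 - x 0) (y 1 - x 1) (by omega) (by omega) (by omega) (by omega)
    (by convert h using 1; ring) (by convert h' using 1; ring)
  funext j
  match j with
  | 0 => omega
  | 1 => omega

end LatHom

section Tilt16b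

/-- **Four-copy presentation of the tilted torus `ℤ²/⟨(4,0),(2,4)⟩` inside `(ℤ/8)²`**:
`ℤ² →+ (ℤ/8)²`, `(x, y) ↦ (4x, 2x + y)` (`e₀ ↦ (4,2)`, `e₁ ↦ (0,1)`). It kills `(4,0)` and `(2,4)`
and its image `{(0,k), (4,2+k) : k ∈ ℤ/8} ≅ ℤ/2 × ℤ/8` has index `4` in `(ℤ/8)²`, so its kernel is
exactly `Λ₁₆″` and `homHubbard tiltHom16b t U` is the disjoint union of four copies (one per coset
of the image) of the nearest-neighbour Hubbard model of the bipartite 16-site torus `ℤ²/Λ₁₆″`.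
[folklore] -/
def tiltHom16b : Site 2 →+ TorusSite 2 8 := latHom 8 ![![4, 0], ![2, 1]]

/-- The two generators of `Λ₁₆″ = ⟨(4,0),(2,4)⟩` lie in the kernel of `tiltHom16b`. [folklore] -/
theorem tiltHom16b_generators : tiltHom16b ![4, 0] = 0 ∧ tiltHom16b ![2, 4] = 0 := by
  refine ⟨?_, ?_⟩ <;> funext j <;>
    simp only [tiltHom16b, latHom_apply, Fin.sum_univ_two, Matrix.cons_val_zero, Matrix.cons_val_one,
      Pi.zero_apply] <;>
    match j with
    | 0 => decide
    | 1 => decide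

/-- **Window certificate ⇒ the four-copy `(ℤ/8)²` presentation of the tilted torus
`ℤ²/⟨(4,0),(2,4)⟩` (kernel).** A square-lattice window certificate (`hubbardFermionInteraction 2 t U`,
data of `groundEnergyAt_div_ge_of_window_certificate`) whose window `Λ'` has coordinate spreads
`≤ 3` and `≤ 3` bounds the `S^z = 0` ground-energy density of the 64-site model
`homHubbard tiltHom16b t U` (four disjoint copies of the `Λ₁₆″` torus), every `n ≤ 64`:
`c − Σ‖aₖ‖ + (Σ_σ μ_σ)(n/64 − ν) ≤ minEnergyOn (szSector 2n 0) / 64`. Window injectivity is the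
finite fact "`8 ∣ 4a`, `8 ∣ 2a + b`, `|a| ≤ 3`, `|b| ≤ 3` ⇒ `a = b = 0`" (`omega`); hop non-degeneracy
is "`(4,2), (4,6), (0,1), (0,7)` pairwise distinct in `(ℤ/8)²`" (`decide`). The further reduction of the
64-site sector minimum to `4 ×` a 16-site sector minimum (product state over the four copies) is NOT
part of this theorem. [cite: Han2020Bootstrap, §3] -/
theorem tilt16b_minEnergyOn_div_ge_of_window_certificate (t U : ℝ) {nh : ℕ}
    (hn : nh ≤ Fintype.card (FermionTorus 2 8))
    {Λ Λ' : Finset (Site 2)} (hΛ : Λ ⊆ Λ')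
    (hspread : ∀ x ∈ Λ', ∀ y ∈ Λ', |x 0 - y 0| ≤ (3 : ℤ) ∧ |x 1 - y 1| ≤ (3 : ℤ))
    (hclosed : ∀ x ∈ Λ, ∀ i : Fin 2, x + unitVec i ∈ Λ' ∧ x - unitVec i ∈ Λ')
    (h0 : thicken ({0} : Finset (Site 2)) 1 ⊆ Λ') (hz : (0 : Site 2) ∈ Λ')
    (μ : Fin 2 → ℝ) (ν : ℝ)
    {m : Type*} [Fintype m] [DecidableEq m] {Λm : Matrix m m ℂ} (hΛm : Λm.PosSemidef)
    (O : m → FermionOp Λ')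
    {κ : Type*} (s : Finset κ) (B : κ → FermionOp Λ)
    {ι : Type*} (tt : Finset ι) (v : ι → Site 2) (hsh : ∀ l, shiftSet (v l) Λ ⊆ Λ') (Y : ι → FermionOp Λ)
    {γ : Type*} (u : Finset γ) (b : γ → ℂ) (cw : γ → List (Orb (PolySite Λ') × Bool))
    (hcw : ∀ j ∈ u, ladderCharge (cw j) ≠ 0 ∨ ladderSpinCharge (cw j) ≠ 0)
    {δ : Type*} (ah : Finset δ) (dc : δ → ℝ) (V : δ → FermionOp Λ')
    {κ'' : Type*} (w : Finset κ'') (a : κ'' → ℂ) (word : κ'' → List (Orb (PolySite Λ') × Bool)) {c : ℝ}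
    (hcert : fermionEmbed (PolySite.incl h0) ((hubbardFermionInteraction 2 t U).meanEnergyObs 1) -
        (c : ℂ) • (1 : FermionOp Λ') -
        ∑ σ : Fin 2, ((μ σ : ℝ) : ℂ) • (nAt 0 hz σ - ((ν : ℝ) : ℂ) • (1 : FermionOp Λ')) =
      gramForm Λm O +
        (∑ k ∈ s, ((hubbardFermionInteraction 2 t U).localHamiltonian Λ' * fermionEmbed (PolySite.incl hΛ) (B k) -
            fermionEmbed (PolySite.incl hΛ) (B k) * (hubbardFermionInteraction 2 t U).localHamiltonian Λ') +
          ∑ l ∈ tt, (fermionEmbed (PolySite.incl (hsh l)) (fermionEmbed (PolySite.shiftEmb (v l) Λ) (Y l)) -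
            fermionEmbed (PolySite.incl hΛ) (Y l)) +
          ∑ j ∈ u, b j • ladderWord (cw j)) +
        (∑ m' ∈ ah, ((dc m' : ℝ) : ℂ) • ((V m')ᴴ - V m') + ∑ k ∈ w, a k • ladderWord (word k))) :
    c - ∑ k ∈ w, ‖a k‖ + (∑ σ : Fin 2, μ σ) * ((nh : ℝ) / 64 - ν) ≤
      (homHubbard tiltHom16b t U).minEnergyOn (szSector (2 * nh) 0) / 64 := by
  have hInj' : Set.InjOn tiltHom16b ↑Λ' :=
    injOn_latHom_two_two_of_spread 8 ![![4, 0], ![2, 1]] (M₀ := 3) (M₁ := 3)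
      (fun a' b' h₁ h₂ h₃ h₄ h₅ h₆ => by
        simp only [Matrix.cons_val_zero, Matrix.cons_val_one] at h₅ h₆
        omega) hspread
  have hd : Function.Injective (signedHop tiltHom16b) :=
    injective_signedHop_latHom 8 ![![4, 0], ![2, 1]] (by decide)
  have h := homTorus_minEnergyOn_div_ge_of_window_certificate tiltHom16b t U hd hn hΛ hclosed h0 hz hInj' μ ν
    hΛm O s B tt v hsh Y u b cw hcw ah dc V w a word hcert
  have h64 : ((8 : ℕ) : ℝ) ^ 2 = 64 := by norm_num
  rw [h64] at h
  exact h

end Tilt16b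

end Summit.Ventures.CertifiedManyBodySolver.Rows

end
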